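import Summits.ResolutionOfSingularities.ResolutionOfSingularities.Theorems.FrobeniusLadderFInjectiveMacaulayficationE8WeightedData
import Summits.ResolutionOfSingularities.ResolutionOfSingularities.Theorems.FrobeniusLadderFInjectiveMacaulayficationQ6JacobianCertX
import Summits.ResolutionOfSingularities.ResolutionOfSingularities.Theorems.FrobeniusLadderFInjectiveMacaulayficationQ6JacobianCertYZ
import Mathlib.Algebra.MvPolynomial.PDeriv
import Mathlib.Algebra.CharP.Lemmas
import HarnessLib

/-!
# Q6 (C6): the specimen `f₂ = x³y³ + x³z³ + y³z³ + z⁶ + x⁸ + y⁸` is regular off the origin in characteristic `5`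
# — the `hoff` input of the CN engine for the Q6 calibration (crux `FInjectiveMacaulayfication`, chain w45a, §18)

Support file for crux stmt-ResolutionOfSingularities-15315 (`FrobeniusLadder.FInjectiveMacaulayfication`), chain w45a,
seat res-L1-w45a-stub-7 (= res-D-pv-019 after the D→L conversion). [OURS · L1 W4.5a] — NOT a statement of the
manuscript under review; AI-written, weaker than expert review. Ruling of record: res-L1-w45a-plan-1 CRUX-PLAN v7 (R7.3′)
«(C6) hoff = SEPARATE file …Q6OffOrigin.lean (clause at closed points of V(f₂) off 0 over every field ⊇ 𝔽₅)».

The Q6 calibration of the Cartier–Newton engine (`CNConeFiModel.cnConeFiModel`, p495573; closing stub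
`stub_q6CNFiModel_char5` of `L/w45a/Stubs-v19.lean`) is the hypersurface

  `f = X₀³X₁³ + X₀³X₂³ + X₁³X₂³ + X₂⁶ + X₀⁸ + X₁⁸ ∈ k[X₀, X₁, X₂]`, `char k = 5`,

an isolated non-F-pure point outside the classes A ∪ 𝒞_face (res-L1-w45a-idea-2, `Q6-fan.json` 4c41e681b86ed32f). The
engine's hypothesis `hoff` asks the crux clause (every system of parameters weakly regular, every parameter ideal Frobenius
closed) at every maximal ideal of `R = k[X]/(f)` missing some `x̄ⱼ`. This file proves it exactly as for `E₈⁰`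
(`E8OffCentreRegular`, p138059; `E8WeightedData.offOrigin_clause_of_regular`): `R` is REGULAR at every prime not containing
`𝔪 = (x̄₀, x̄₁, x̄₂)`, by the Jacobian criterion at an arbitrary prime (`HypersurfaceRegular.stub_hypersurfaceRegularOfPderiv`,
Matsumura Thm. 30.4 (ii)), because the Jacobian ideal `(f, ∂₀f, ∂₁f, ∂₂f)` contains `X₀¹¹, X₁¹¹, X₂¹¹` in characteristic `5`
— the kernel-checked cofactor certificates of `Q6JacobianCertX` / `Q6JacobianCertYZ` (res-L1-w45a-idea-2's kit job j267549,
`Q6-fan-hoff.json` sha16 0f091e3420207ff6, lifted to `ℤ`), specialised to `x, y, z := X 0, X 1, X 2`.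

* `pderiv_zero_q6`, `pderiv_one_q6`, `pderiv_two_q6` — the three partial derivatives (any commutative ring);
* `five_eq_zero` — `5 = 0` in `k[X]` for `char k = 5`;
* `X_pow_eleven_mem_of_jacobian` — for `char k = 5`, an ideal of `k[X]` containing `f` and its partials contains every `Xⱼ¹¹`;
* `q6OffCentreRegular` — `R_P` is regular for every prime `P ⊉ 𝔪` of `R = k[X]/(f)`;
* `q6_offOrigin_clause_char5` — the `hoff` binder of `CNConeFiModel.cnConeFiModel` for this `f` at `p = 5`, VERBATIM.

No definitions, no named facts, no `sorry`. [folklore]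
-/

-- single-problem summit: the doubled namespace component is forced
set_option linter.dupNamespace false

noncomputable section

namespace Summit.ResolutionOfSingularities.ResolutionOfSingularities.Theorems.FInjectiveMacaulayfication.Q6OffOrigin

open MvPolynomial

/-! ## The partial derivatives of `f` -/

/-- **`∂f/∂X₀ = 8X₀⁷ + 3X₀²X₁³ + 3X₀²X₂³`** for `f = X₀³X₁³ + X₀³X₂³ + X₁³X₂³ + X₂⁶ + X₀⁸ + X₁⁸`, over any commutative
ring. [folklore] -/
theorem pderiv_zero_q6 {A : Type*} [CommRing A] :
    pderiv 0 (X 0 ^ 3 * X 1 ^ 3 + X 0 ^ 3 * X 2 ^ 3 + X 1 ^ 3 * X 2 ^ 3 + X 2 ^ 6 + X 0 ^ 8 + X 1 ^ 8 :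
      MvPolynomial (Fin 3) A) = 8 * X 0 ^ 7 + 3 * X 0 ^ 2 * X 1 ^ 3 + 3 * X 0 ^ 2 * X 2 ^ 3 := by
  simp only [map_add, pderiv_mul, pderiv_pow, pderiv_X_self, pderiv_X_of_ne (show (1 : Fin 3) ≠ 0 by decide),
    pderiv_X_of_ne (show (2 : Fin 3) ≠ 0 by decide), mul_zero, zero_mul, add_zero, mul_one]
  push_cast
  ring

/-- **`∂f/∂X₁ = 3X₀³X₁² + 8X₁⁷ + 3X₁²X₂³`**, over any commutative ring. [folklore] -/
theorem pderiv_one_q6 {A : Type*} [CommRing A] :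
    pderiv 1 (X 0 ^ 3 * X 1 ^ 3 + X 0 ^ 3 * X 2 ^ 3 + X 1 ^ 3 * X 2 ^ 3 + X 2 ^ 6 + X 0 ^ 8 + X 1 ^ 8 :
      MvPolynomial (Fin 3) A) = 3 * X 0 ^ 3 * X 1 ^ 2 + 8 * X 1 ^ 7 + 3 * X 1 ^ 2 * X 2 ^ 3 := by
  simp only [map_add, pderiv_mul, pderiv_pow, pderiv_X_self, pderiv_X_of_ne (show (0 : Fin 3) ≠ 1 by decide),
    pderiv_X_of_ne (show (2 : Fin 3) ≠ 1 by decide), mul_zero, zero_mul, add_zero, zero_add, mul_one]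
  push_cast
  ring

/-- **`∂f/∂X₂ = 3X₀³X₂² + 3X₁³X₂² + 6X₂⁵`**, over any commutative ring. [folklore] -/
theorem pderiv_two_q6 {A : Type*} [CommRing A] :
    pderiv 2 (X 0 ^ 3 * X 1 ^ 3 + X 0 ^ 3 * X 2 ^ 3 + X 1 ^ 3 * X 2 ^ 3 + X 2 ^ 6 + X 0 ^ 8 + X 1 ^ 8 :
      MvPolynomial (Fin 3) A) = 3 * X 0 ^ 3 * X 2 ^ 2 + 3 * X 1 ^ 3 * X 2 ^ 2 + 6 * X 2 ^ 5 := by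
  simp only [map_add, pderiv_mul, pderiv_pow, pderiv_X_self, pderiv_X_of_ne (show (0 : Fin 3) ≠ 2 by decide),
    pderiv_X_of_ne (show (1 : Fin 3) ≠ 2 by decide), mul_zero, zero_mul, add_zero, zero_add, mul_one]
  push_cast
  ring

/-! ## Regularity off the origin and the `hoff` clause -/

/-- **`5 = 0` in `k[X]`** for a commutative ring `k` of characteristic `5`. [folklore] -/
theorem five_eq_zero (k : Type*) [CommRing k] [CharP k 5] {n : ℕ} : (5 : MvPolynomial (Fin n) k) = 0 := by
  have h := CharP.cast_eq_zero (MvPolynomial (Fin n) k) 5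
  simpa using h

/-- **The Jacobian ideal of `f` contains `X₀¹¹, X₁¹¹, X₂¹¹` in characteristic `5`**: every ideal `I ⊆ k[X₀,X₁,X₂]`
(`char k = 5`) containing `f = X₀³X₁³ + X₀³X₂³ + X₁³X₂³ + X₂⁶ + X₀⁸ + X₁⁸` and its three partial derivatives contains
`Xⱼ¹¹` for `j = 0, 1, 2` — the certificates `Q6JacobianCertX.x_pow_eleven_mem`, `Q6JacobianCertYZ.y_pow_eleven_mem`,
`Q6JacobianCertYZ.z_pow_eleven_mem` at `x, y, z := X 0, X 1, X 2`. [folklore] -/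
theorem X_pow_eleven_mem_of_jacobian (k : Type) [Field k] [CharP k 5] (f : MvPolynomial (Fin 3) k)
    (hf : f = X 0 ^ 3 * X 1 ^ 3 + X 0 ^ 3 * X 2 ^ 3 + X 1 ^ 3 * X 2 ^ 3 + X 2 ^ 6 + X 0 ^ 8 + X 1 ^ 8)
    (I : Ideal (MvPolynomial (Fin 3) k)) (hfI : f ∈ I) (h0 : pderiv 0 f ∈ I) (h1 : pderiv 1 f ∈ I)
    (h2 : pderiv 2 f ∈ I) : ∀ j : Fin 3, (X j : MvPolynomial (Fin 3) k) ^ 11 ∈ I := by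
  have h5 := five_eq_zero k (n := 3)
  rw [hf] at hfI h0 h1 h2
  rw [pderiv_zero_q6] at h0
  rw [pderiv_one_q6] at h1
  rw [pderiv_two_q6] at h2
  intro j
  match j with
  | 0 => exact Q6JacobianCertX.x_pow_eleven_mem h5 I (X 0) (X 1) (X 2) hfI h0 h1 h2
  | 1 => exact Q6JacobianCertYZ.y_pow_eleven_mem h5 I (X 0) (X 1) (X 2) hfI h0 h1 h2
  | 2 => exact Q6JacobianCertYZ.z_pow_eleven_mem h5 I (X 0) (X 1) (X 2) hfI h0 h1 h2

/-- **Q6 is regular off the origin in characteristic `5`**: for a field `k` of characteristic `5`,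
`f = X₀³X₁³ + X₀³X₂³ + X₁³X₂³ + X₂⁶ + X₀⁸ + X₁⁸ ∈ S = k[X₀,X₁,X₂]`, `R = S/(f)`, and a prime `P` of `R` not containing
`𝔪 = (x̄₀, x̄₁, x̄₂)`, the local ring `R_P` is regular. Proof: with `P₀ = P ∩ S ∋ f`, some `∂ᵢf ∉ P₀` — otherwise
`X_pow_eleven_mem_of_jacobian` puts `X₀¹¹, X₁¹¹, X₂¹¹`, hence `X₀, X₁, X₂`, in the prime `P₀`, i.e. `𝔪 ≤ P` — and the
Jacobian criterion at an arbitrary prime (`HypersurfaceRegular.stub_hypersurfaceRegularOfPderiv`, Matsumura 30.4 (ii))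
applies in that direction `i`. [folklore] -/
theorem q6OffCentreRegular : ∀ (k : Type) [Field k] [CharP k 5] (f : MvPolynomial (Fin 3) k),
    f = MvPolynomial.X 0 ^ 3 * MvPolynomial.X 1 ^ 3 + MvPolynomial.X 0 ^ 3 * MvPolynomial.X 2 ^ 3 +
        MvPolynomial.X 1 ^ 3 * MvPolynomial.X 2 ^ 3 + MvPolynomial.X 2 ^ 6 + MvPolynomial.X 0 ^ 8 + MvPolynomial.X 1 ^ 8 →
    ∀ (P : Ideal (MvPolynomial (Fin 3) k ⧸ Ideal.span {f})) [P.IsPrime],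
      ¬ Ideal.span (Set.range fun j : Fin 3 => Ideal.Quotient.mk (Ideal.span {f}) (MvPolynomial.X j)) ≤ P →
      IsRegularLocalRing (Localization.AtPrime P) := by
  intro k _ _ f hf P _ hP
  haveI hprime : (P.comap (Ideal.Quotient.mk (Ideal.span {f}))).IsPrime := Ideal.comap_isPrime _ _
  have hfP : f ∈ P.comap (Ideal.Quotient.mk (Ideal.span {f})) := by
    rw [Ideal.mem_comap, Ideal.Quotient.eq_zero_iff_mem.mpr (Ideal.mem_span_singleton_self f)]
    exact P.zero_mem
  by_cases hd0 : pderiv 0 f ∈ P.comap (Ideal.Quotient.mk (Ideal.span {f})); swap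
  · exact HypersurfaceRegular.stub_hypersurfaceRegularOfPderiv k 3 f 0 P hd0
  by_cases hd1 : pderiv 1 f ∈ P.comap (Ideal.Quotient.mk (Ideal.span {f})); swap
  · exact HypersurfaceRegular.stub_hypersurfaceRegularOfPderiv k 3 f 1 P hd1
  by_cases hd2 : pderiv 2 f ∈ P.comap (Ideal.Quotient.mk (Ideal.span {f})); swap
  · exact HypersurfaceRegular.stub_hypersurfaceRegularOfPderiv k 3 f 2 P hd2
  -- all three partials vanish on `P₀`: then `Xⱼ¹¹ ∈ P₀`, so `Xⱼ ∈ P₀` for all `j`, so `𝔪 ≤ P` — excluded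
  exfalso
  refine hP ?_
  have hX := X_pow_eleven_mem_of_jacobian k f hf _ hfP hd0 hd1 hd2
  rw [Ideal.span_le, Set.range_subset_iff]
  intro j
  exact hprime.mem_of_pow_mem 11 (hX j)

/-- **Q6, characteristic `5`: the off-origin clause** — the hypothesis `hoff` of `CNConeFiModel.cnConeFiModel` (p495573) /
`WeightedConeCore.weightedConeFiModel_of_chartClause` for `f = X₀³X₁³ + X₀³X₂³ + X₁³X₂³ + X₂⁶ + X₀⁸ + X₁⁸` at `p = 5`,
VERBATIM: at every maximal ideal `Q` of `k[X]/(f)` missing some `x̄ⱼ`, every system of parameters of the local ring is weakly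
regular and every parameter ideal is Frobenius closed (regular local rings satisfy the clause,
`E8WeightedData.offOrigin_clause_of_regular`). [folklore] -/
theorem q6_offOrigin_clause_char5 (k : Type) [Field k] [CharP k 5] (f : MvPolynomial (Fin 3) k)
    (hf : f = MvPolynomial.X 0 ^ 3 * MvPolynomial.X 1 ^ 3 + MvPolynomial.X 0 ^ 3 * MvPolynomial.X 2 ^ 3 +
        MvPolynomial.X 1 ^ 3 * MvPolynomial.X 2 ^ 3 + MvPolynomial.X 2 ^ 6 + MvPolynomial.X 0 ^ 8 + MvPolynomial.X 1 ^ 8) :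
    ∀ (Q : Ideal (MvPolynomial (Fin 3) k ⧸ Ideal.span {f})) [Q.IsMaximal],
      (∃ j : Fin 3, Ideal.Quotient.mk (Ideal.span {f}) (MvPolynomial.X j) ∉ Q) →
      ∀ d : ℕ, ringKrullDim (Localization.AtPrime Q) = d → ∀ s : Fin d → Localization.AtPrime Q,
        (Ideal.span (Set.range s)).radical.IsMaximal →
          RingTheory.Sequence.IsWeaklyRegular (Localization.AtPrime Q) (List.ofFn s) ∧
          ∀ y : Localization.AtPrime Q, (∃ e : ℕ, y ^ 5 ^ e ∈ Ideal.span
            ((fun z : Localization.AtPrime Q => z ^ 5 ^ e) ''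
              (Ideal.span (Set.range s) : Set (Localization.AtPrime Q)))) → y ∈ Ideal.span (Set.range s) := by
  haveI : Fact (Nat.Prime 5) := ⟨Nat.prime_five⟩
  exact E8WeightedData.offOrigin_clause_of_regular 5 k f (fun P _ hP => q6OffCentreRegular k f hf P hP)

end Summit.ResolutionOfSingularities.ResolutionOfSingularities.Theorems.FInjectiveMacaulayfication.Q6OffOrigin

end
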